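/-
Copyright (c) 2026. All rights reserved.
Released under Apache 2.0 license as described in the file LICENSE.
Authors: abc-iut cell, seat abc-iut-f-069 (gen 4; row «DPSC-NODAL-MODEL»).
-/
import Literature.AnabelianGeometry.AbsoluteAnabelian.AbsTopII.DehnTwistVertexTerminal
import HarnessLib

/-!
# [AbsTopII] Prop 1.3 (iv′) and (v) at the NODAL Dehn-twist datum

S. Mochizuki, *Topics in Absolute Anabelian Geometry II* [AbsTopII] (bib `MochizukiAbsTopII2013`; locators = PDF
pages of the kurims manuscript `paper:url-585b8d0ad0d9`), §1 Prop 1.3 (iv) p. 11 (the trichotomy for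
`D_v ∩ D_{v'} ∩ Π_I ≠ 1` and "`I_v ∩ I_{v'} ≠ 1 ⇒ v = v'`"), (v) p. 12 ("`D_v = C_{Π_H}(I_v) = N_{Π_H}(I_v)` is
commensurably terminal in `Π_H`; `D_v ∩ Π_𝔾 = Π_v` is commensurably terminal in `Π_𝔾`").

PROOF-ONLY (no definition), abc-iut-f-069 (gen 4), row «DPSC-NODAL-MODEL» (after abc-iut-L4-t6 g7's DONE 18:11Z the
open list was: (iii′) vertex — closed by `DehnTwistVertexTerminal`; (iv)/(v) at `dpsc` — this file; two-vertex
model).  At `X = DehnTwist.dpsc i hi` (`Π_H = Π_I = F̂₂ ⋊_{shear^i} Ẑ`, one vertex, `Π_v = vertGp`, `I_v = 1 ⋊ Ẑ`,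
`D_v = N(Π_v × 1) = Π_v ⋊ Ẑ` by `isCommensurablyTerminal_vertGp`):

* `prop13iv'_dpsc_holds` — **Prop 1.3 (iv′)** (the printed `Π_𝔾`-scope typing `DPSCData.Prop13iv'`) and
  `prop13iv_dpsc_holds` (the superseded `Π_H`-scope `Prop13iv`) HOLD — trivially here (ONE vertex: both
  conclusions are `v = v'`); recorded for the census, not as content;
* **Prop 1.3 (v)**: of the five typed clauses of `DPSCData.Prop13v`, THREE hold with no hypothesis —
  `isCommensurablyTerminal_Dv_dpsc` (`D_v = Π_v ⋊ Ẑ` is commensurably terminal in `Π_H`, by the generic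
  `isCommensurablyTerminal_map_inl_sup_range_inr` over `isCommensurablyTerminal_vertGp`), `Dv_inf_PiG_dpsc`
  (`D_v ∩ Π_𝔾 = Π_v`), `isCommensurablyTerminal_vertSub_subgroupOf_dpsc` (`Π_v` commensurably terminal in `Π_𝔾`);
  the two remaining clauses `D_v = C_{Π_H}(I_v)`, `D_v = N_{Π_H}(I_v)` are EQUIVALENT at this datum to a statement
  about the Dehn twist alone — an element of `Π_H` commensurates the twist section `1 ⋊ Ẑ` iff its `F̂₂`-component
  is fixed by a power of the twist (`exists_forall_shearPow_pow_eq_of_commensurable`) — so `prop13v_dpsc_of_fix`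
  proves the typed `Prop13v` MODULO the one named input
  «HFix: `∀ x n, 0 < n → (∀ k, shear^{i}(k^n) x = x) → x ∈ Π_v`» (the fixed subgroup of a non-trivial power of the
  Dehn twist of `F̂₂` is the vertex group; profinite Bass–Serre theory — NOT in the tree, not claimed).
HONEST FRAMING: classical group theory in a constructed model (constructed ≠ geometric); typed ≠ proved for HFix;
nothing here bears on [IUTchIII] Cor 3.12; no side taken.
-/

noncomputable section

open scoped Pointwise

namespace Literature.AnabelianGeometry.AbsoluteAnabelian.AbsTopII.DehnTwist

open Literature.AnabelianGeometry.EtaleTheta.SettingModel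
open Literature.AnabelianGeometry.AbsoluteAnabelian
open Function _root_.Topology

section ExtLevel

variable (i : ℕ)

/-! ### The twist section `1 ⋊ Ẑ` and its conjugates -/

/-- Conjugating the twist section: `g · (1,k) · g⁻¹ = (g.left · (shear^i(k) g.left)⁻¹, k)` (`Ẑ` is commutative).
[cite: MochizukiAbsTopII2013, Prop 1.3 (v) p.12] -/
theorem conj_inr_eq (g : Ext i) (k : ZH) :
    g * SemidirectProduct.inr k * g⁻¹ =
      SemidirectProduct.inl (g.left * (shearPow i k g.left)⁻¹) * SemidirectProduct.inr k := by
  have hcomm : (SemidirectProduct.inr g.right : Ext i) * SemidirectProduct.inr k * SemidirectProduct.inr g.right⁻¹ =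
      SemidirectProduct.inr k := by
    rw [← map_mul, ← map_mul, ZHatCompletion.mul_comm g.right k, mul_inv_cancel_right]
  have haut : (SemidirectProduct.inr k : Ext i) * SemidirectProduct.inl g.left⁻¹ =
      SemidirectProduct.inl (shearPow i k g.left⁻¹) * SemidirectProduct.inr k := by
    rw [SemidirectProduct.inl_aut, map_inv (SemidirectProduct.inr : ZH →* Ext i) k, inv_mul_cancel_right]
  conv_lhs => rw [← SemidirectProduct.inl_left_mul_inr_right g]
  rw [mul_inv_rev, ← map_inv, ← map_inv]
  calc SemidirectProduct.inl g.left * SemidirectProduct.inr g.right * SemidirectProduct.inr k *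
        (SemidirectProduct.inr g.right⁻¹ * SemidirectProduct.inl g.left⁻¹)
      = SemidirectProduct.inl g.left * (SemidirectProduct.inr g.right * SemidirectProduct.inr k *
          SemidirectProduct.inr g.right⁻¹) * SemidirectProduct.inl g.left⁻¹ := by
        simp only [mul_assoc]
    _ = SemidirectProduct.inl g.left * (SemidirectProduct.inr k * SemidirectProduct.inl g.left⁻¹) := by
        rw [hcomm, mul_assoc]
    _ = SemidirectProduct.inl (g.left * (shearPow i k g.left)⁻¹) * SemidirectProduct.inr k := by
        rw [haut, ← mul_assoc, ← map_mul, map_inv]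

/-- If `(1,k') ∈ g · (1 ⋊ Ẑ) · g⁻¹` then `g.left` is fixed by `shear^i(k')`.
[cite: MochizukiAbsTopII2013, Prop 1.3 (v) p.12] -/
theorem shearPow_left_eq_of_inr_mem_conj {g : Ext i} {k' : ZH}
    (h : (SemidirectProduct.inr k' : Ext i) ∈ MulAut.conj g • (SemidirectProduct.inr : ZH →* Ext i).range) :
    shearPow i k' g.left = g.left := by
  rw [Subgroup.mem_smul_pointwise_iff_exists] at h
  obtain ⟨_, ⟨k, rfl⟩, hk⟩ := h
  rw [MulAut.smul_def, MulAut.conj_apply, conj_inr_eq] at hk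
  have hr := congrArg SemidirectProduct.right hk
  simp only [SemidirectProduct.mul_right, SemidirectProduct.right_inl, SemidirectProduct.right_inr, one_mul] at hr
  have hl := congrArg SemidirectProduct.left hk
  simp only [SemidirectProduct.mul_left, SemidirectProduct.left_inl, SemidirectProduct.right_inl,
    SemidirectProduct.left_inr, map_one, mul_one] at hl
  -- `hl : g.left * (φ_k g.left)⁻¹ = 1`, `hr : k = k'`
  rw [← hr]
  rw [mul_inv_eq_one] at hl
  exact hl.symm

/-- The powers `ι(m) = ι(1)^m` lie in `⟨ι(1)⟩`, which is therefore dense in `Ẑ`. [cite: RibesZalesskii2010, Thm 2.7.1] -/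
theorem closure_zpowers_iotaZ_one_eq_top :
    (Subgroup.zpowers (iotaZ (Multiplicative.ofAdd 1))).topologicalClosure = ⊤ := by
  apply SetLike.coe_injective
  rw [Subgroup.topologicalClosure_coe, Subgroup.coe_top]
  have hdense : DenseRange iotaZ := ProfiniteGrp.ProfiniteCompletion.denseRange (G := GrpCat.of (Multiplicative ℤ))
  refine (hdense.mono ?_).closure_eq
  rintro _ ⟨m, rfl⟩
  refine ⟨Multiplicative.toAdd m, ?_⟩
  change iotaZ (Multiplicative.ofAdd 1) ^ Multiplicative.toAdd m = iotaZ m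
  rw [← map_zpow, ← ofAdd_zsmul, smul_eq_mul, mul_one, ofAdd_toAdd]

/-- If an automorphism fixes `x`, so do all its integer powers. [cite: MochizukiAbsTopII2013, Prop 1.3 (v) p.12] -/
theorem mulAut_zpow_apply_eq_self {G : Type*} [Group G] {φ : MulAut G} {x : G} (h : φ x = x) (m : ℤ) :
    (φ ^ m) x = x := by
  have hnat : ∀ n : ℕ, (φ ^ n) x = x := by
    intro n
    induction n with
    | zero => rw [pow_zero, MulAut.one_apply]
    | succ n ih => rw [pow_succ, MulAut.mul_apply, h, ih]
  cases m with
  | ofNat n => rw [Int.ofNat_eq_natCast, zpow_natCast, hnat]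
  | negSucc n => rw [zpow_negSucc, MulAut.inv_apply, MulEquiv.symm_apply_eq, hnat]

/-- If `shear^i(ι(1)^n)` fixes `x`, then `shear^i(k^n)` fixes `x` for EVERY `k ∈ Ẑ` (the set of such `k` is closed,
contains every integer power of the topological generator `ι(1)`, and `ι(ℤ)` is dense).
[cite: MochizukiAbsTopII2013, Prop 1.3 (v) p.12] -/
theorem forall_shearPow_pow_eq_of_generator {x : F₂hatT} {n : ℕ}
    (hx : shearPow i (iotaZ (Multiplicative.ofAdd 1) ^ n) x = x) (k : ZH) : shearPow i (k ^ n) x = x := by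
  -- the fixed set is closed
  have hcont : Continuous fun k : ZH => shearPow i (k ^ n) x := by
    have h1 : Continuous fun k : ZH => ((k ^ n, x) : ZH × F₂hatT) := (continuous_pow n).prodMk continuous_const
    have h2 := (continuous_shearPow i).comp h1
    simpa only [Function.comp_def] using h2
  have hcl : IsClosed {k : ZH | shearPow i (k ^ n) x = x} := isClosed_eq hcont continuous_const
  -- it contains `ι(ℤ)`: `shear^i((ι1^m)^n) = (shear^i(ι1^n))^m`
  have hsub : Set.range iotaZ ⊆ {k : ZH | shearPow i (k ^ n) x = x} := by
    rintro _ ⟨m, rfl⟩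
    have hm : iotaZ m = iotaZ (Multiplicative.ofAdd 1) ^ Multiplicative.toAdd m := by
      rw [← map_zpow, ← ofAdd_zsmul, smul_eq_mul, mul_one, ofAdd_toAdd]
    simp only [Set.mem_setOf_eq]
    rw [hm, ← zpow_natCast, ← zpow_mul, mul_comm, zpow_mul, zpow_natCast, map_zpow]
    exact mulAut_zpow_apply_eq_self hx _
  -- density of `ι(ℤ)`
  have hdense : DenseRange iotaZ := ProfiniteGrp.ProfiniteCompletion.denseRange (G := GrpCat.of (Multiplicative ℤ))
  have hall : closure (Set.range iotaZ) ⊆ {k : ZH | shearPow i (k ^ n) x = x} := hcl.closure_subset_iff.mpr hsub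
  rw [hdense.closure_range] at hall
  exact hall (Set.mem_univ k)

/-- **An element commensurating the twist section is fixed, on its `F̂₂`-component, by a non-trivial power of the
twist**: `∃ n ≥ 1, ∀ k, shear^i(k^n)(g.left) = g.left` (a positive power of the topological generator lies in the
conjugate; then the previous lemma). [cite: MochizukiAbsTopII2013, Prop 1.3 (v) p.12] -/
theorem exists_forall_shearPow_pow_eq_of_commensurable {g : Ext i}
    (hg : Subgroup.Commensurable (MulAut.conj g • (SemidirectProduct.inr : ZH →* Ext i).range)
      (SemidirectProduct.inr : ZH →* Ext i).range) :
    ∃ n : ℕ, 0 < n ∧ ∀ k : ZH, shearPow i (k ^ n) g.left = g.left := by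
  have hmem1 : (SemidirectProduct.inr (iotaZ (Multiplicative.ofAdd 1)) : Ext i) ∈
      (SemidirectProduct.inr : ZH →* Ext i).range := ⟨_, rfl⟩
  obtain ⟨n, hn, hmem⟩ := exists_pow_mem_of_commensurable hg hmem1
  rw [← map_pow] at hmem
  exact ⟨n, hn, forall_shearPow_pow_eq_of_generator i (shearPow_left_eq_of_inr_mem_conj i hmem)⟩

/-- The normalizer is contained in the commensurator. [cite: MochizukiAbsAnab2004, Rem 0.1.2 p.4] -/
theorem normalizer_le_commensurator' {G : Type*} [Group G] (K : Subgroup G) :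
    Subgroup.normalizer (K : Set G) ≤ Subgroup.Commensurable.commensurator K := by
  intro g hg
  rw [Subgroup.Commensurable.commensurator_mem_iff, Subgroup.conjAct_pointwise_smul_eq_self hg]

/-- `Π_v ⋊ Ẑ` normalises the twist section: for `x ∈ Π_v`, `(x,m)·(1,k)·(x,m)⁻¹ = (1,k)`.
[cite: MochizukiAbsTopII2013, Prop 1.3 (v) p.12] -/
theorem map_inl_vertGp_sup_le_normalizer_range_inr :
    vertGp.map (SemidirectProduct.inl : F₂hatT →* Ext i) ⊔ (SemidirectProduct.inr : ZH →* Ext i).range ≤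
      Subgroup.normalizer (((SemidirectProduct.inr : ZH →* Ext i).range : Subgroup (Ext i)) : Set (Ext i)) := by
  intro g hg
  rw [mem_map_inl_sup_range_inr_iff (shearPow_mem_vertGp_of_mem i)] at hg
  have hfix : ∀ k : ZH, g * SemidirectProduct.inr k * g⁻¹ = SemidirectProduct.inr k := fun k => by
    rw [conj_inr_eq, shearPow_mem_vertGp i k _ hg, mul_inv_cancel, map_one, one_mul]
  rw [← Subgroup.conjAct_pointwise_smul_iff, ← conj_smul_eq_toConjAct_smul]
  ext y
  constructor
  · intro hy
    rw [Subgroup.mem_smul_pointwise_iff_exists] at hy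
    obtain ⟨_, ⟨k, rfl⟩, rfl⟩ := hy
    rw [MulAut.smul_def, MulAut.conj_apply, hfix]
    exact ⟨k, rfl⟩
  · rintro ⟨k, rfl⟩
    rw [Subgroup.mem_smul_pointwise_iff_exists]
    exact ⟨SemidirectProduct.inr k, ⟨k, rfl⟩, by rw [MulAut.smul_def, MulAut.conj_apply, hfix]⟩

/-- **`C_{Π_H}(1 ⋊ Ẑ) = Π_v ⋊ Ẑ` GIVEN the Dehn-twist fixed-subgroup input** `HFix`: an element fixed by a
non-trivial power of the twist lies in `Π_v`. [cite: MochizukiAbsTopII2013, Prop 1.3 (v) p.12] -/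
theorem commensurator_range_inr_eq_of_fix
    (HFix : ∀ (x : F₂hatT) (n : ℕ), 0 < n → (∀ k : ZH, shearPow i (k ^ n) x = x) → x ∈ vertGp) :
    Subgroup.Commensurable.commensurator ((SemidirectProduct.inr : ZH →* Ext i).range) =
      vertGp.map (SemidirectProduct.inl : F₂hatT →* Ext i) ⊔ (SemidirectProduct.inr : ZH →* Ext i).range := by
  refine le_antisymm (fun g hg => ?_) ?_
  · rw [Subgroup.Commensurable.commensurator_mem_iff, ← conj_smul_eq_toConjAct_smul] at hg
    obtain ⟨n, hn, hfix⟩ := exists_forall_shearPow_pow_eq_of_commensurable i hg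
    rw [mem_map_inl_sup_range_inr_iff (shearPow_mem_vertGp_of_mem i)]
    exact HFix g.left n hn hfix
  · exact le_trans (map_inl_vertGp_sup_le_normalizer_range_inr i) (normalizer_le_commensurator' _)

/-- **`N_{Π_H}(1 ⋊ Ẑ) = Π_v ⋊ Ẑ` GIVEN `HFix`** (sandwiched between `Π_v ⋊ Ẑ` and the commensurator).
[cite: MochizukiAbsTopII2013, Prop 1.3 (v) p.12] -/
theorem normalizer_range_inr_eq_of_fix
    (HFix : ∀ (x : F₂hatT) (n : ℕ), 0 < n → (∀ k : ZH, shearPow i (k ^ n) x = x) → x ∈ vertGp) :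
    Subgroup.normalizer (((SemidirectProduct.inr : ZH →* Ext i).range : Subgroup (Ext i)) : Set (Ext i)) =
      vertGp.map (SemidirectProduct.inl : F₂hatT →* Ext i) ⊔ (SemidirectProduct.inr : ZH →* Ext i).range :=
  le_antisymm (le_trans (normalizer_le_commensurator' _) (commensurator_range_inr_eq_of_fix i HFix).le)
    (map_inl_vertGp_sup_le_normalizer_range_inr i)

/-- **`D_v = N(Π_v × 1) = Π_v ⋊ Ẑ`** (the vertex group is normally terminal, `DehnTwistVertexTerminal`).
[cite: MochizukiAbsTopII2013, Prop 1.3 (v) p.12] -/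
theorem normalizer_map_inl_vertGp_eq :
    Subgroup.normalizer ((vertGp.map (SemidirectProduct.inl : F₂hatT →* Ext i) : Subgroup (Ext i)) : Set (Ext i)) =
      vertGp.map (SemidirectProduct.inl : F₂hatT →* Ext i) ⊔ (SemidirectProduct.inr : ZH →* Ext i).range :=
  normalizer_map_inl_eq_of_normalizer_eq (shearPow_mem_vertGp_of_mem i)
    isCommensurablyTerminal_vertGp.isNormallyTerminal.normalizer_eq

/-- **`D_v` is commensurably terminal in `Π_H`** — no hypothesis. [cite: MochizukiAbsTopII2013, Prop 1.3 (v) p.12] -/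
theorem isCommensurablyTerminal_normalizer_map_inl_vertGp :
    IsCommensurablyTerminal (Subgroup.normalizer
      ((vertGp.map (SemidirectProduct.inl : F₂hatT →* Ext i) : Subgroup (Ext i)) : Set (Ext i))) := by
  rw [normalizer_map_inl_vertGp_eq]
  exact isCommensurablyTerminal_map_inl_sup_range_inr (shearPow_mem_vertGp_of_mem i) isCommensurablyTerminal_vertGp

/-- **`D_v ∩ Π_𝔾 = Π_v × 1`** — no hypothesis. [cite: MochizukiAbsTopII2013, Prop 1.3 (v) p.12] -/
theorem normalizer_map_inl_vertGp_inf_range_inl :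
    Subgroup.normalizer ((vertGp.map (SemidirectProduct.inl : F₂hatT →* Ext i) : Subgroup (Ext i)) : Set (Ext i)) ⊓
        (SemidirectProduct.inl : F₂hatT →* Ext i).range =
      vertGp.map (SemidirectProduct.inl : F₂hatT →* Ext i) := by
  rw [normalizer_map_inl_vertGp_eq]
  refine le_antisymm ?_ (le_inf le_sup_left (Subgroup.map_le_range _ _))
  rintro x ⟨hx, ⟨n, rfl⟩⟩
  have hx' := (mem_map_inl_sup_range_inr_iff (shearPow_mem_vertGp_of_mem i) _).mp hx
  rw [SemidirectProduct.left_inl] at hx'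
  exact ⟨n, hx', rfl⟩

/-- **`Π_v × 1` is commensurably terminal in `Π_𝔾 = F̂₂ × 1`** — no hypothesis (transport of
`isCommensurablyTerminal_vertGp` along `inl : F̂₂ ≅ F̂₂ × 1`). [cite: MochizukiAbsTopII2013, Prop 1.3 (v) p.12] -/
theorem isCommensurablyTerminal_map_inl_vertGp_subgroupOf :
    IsCommensurablyTerminal ((vertGp.map (SemidirectProduct.inl : F₂hatT →* Ext i)).subgroupOf
      (SemidirectProduct.inl : F₂hatT →* Ext i).range) := by
  let e : F₂hatT ≃* ↥((SemidirectProduct.inl : F₂hatT →* Ext i).range) :=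
    MonoidHom.ofInjective SemidirectProduct.inl_injective
  have hK : (vertGp.map (SemidirectProduct.inl : F₂hatT →* Ext i)).subgroupOf
      (SemidirectProduct.inl : F₂hatT →* Ext i).range = vertGp.map e.toMonoidHom := by
    ext ⟨y, hy⟩
    rw [Subgroup.mem_subgroupOf, Subgroup.mem_map, Subgroup.mem_map]
    constructor
    · rintro ⟨v, hv, hvy⟩
      exact ⟨v, hv, Subtype.ext hvy⟩
    · rintro ⟨v, hv, hvy⟩
      exact ⟨v, hv, congrArg Subtype.val hvy⟩
  rw [hK]
  refine isCommensurablyTerminal_of_map_of_injective (f := e.symm.toMonoidHom) e.symm.injective ?_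
  rw [Subgroup.map_map]
  have : e.symm.toMonoidHom.comp e.toMonoidHom = MonoidHom.id _ := by
    ext v; exact e.symm_apply_apply v
  rw [this, Subgroup.map_id]
  exact isCommensurablyTerminal_vertGp

end ExtLevel

section Dpsc

variable {i : ℕ} (hi : 0 < i)

/-- **[AbsTopII] Prop 1.3 (iv′) — the typed `DPSCData.Prop13iv'` (printed `Π_𝔾`-scope) — HOLDS at the nodal
Dehn-twist datum**, trivially (ONE vertex: every conclusion is `v = v'`). [cite: MochizukiAbsTopII2013, Prop 1.3 (iv) p.11] -/
theorem prop13iv'_dpsc_holds : (dpsc i hi).toDPSCData.Prop13iv' :=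
  ⟨fun v v' _ _ _ => Or.inl (dpsc_vert_eq hi v v'), fun v v' _ _ _ => dpsc_vert_eq hi v v'⟩

/-- The superseded `Π_H`-scope typing `DPSCData.Prop13iv` also holds here (one vertex).
[cite: MochizukiAbsTopII2013, Prop 1.3 (iv) p.11] -/
theorem prop13iv_dpsc_holds : (dpsc i hi).toDPSCData.Prop13iv :=
  ⟨fun v v' _ _ => Or.inl (dpsc_vert_eq hi v v'), fun v v' _ _ => dpsc_vert_eq hi v v'⟩

/-- **Prop 1.3 (v), clause 3, at the nodal datum — no hypothesis: `D_v` is commensurably terminal in `Π_H`.**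
[cite: MochizukiAbsTopII2013, Prop 1.3 (v) p.12] -/
theorem isCommensurablyTerminal_Dv_dpsc (v : (dpsc i hi).Vert) : IsCommensurablyTerminal ((dpsc i hi).Dv v) :=
  isCommensurablyTerminal_normalizer_map_inl_vertGp i

/-- **Prop 1.3 (v), clause 4 — no hypothesis: `D_v ∩ Π_𝔾 = Π_v`.** [cite: MochizukiAbsTopII2013, Prop 1.3 (v) p.12] -/
theorem Dv_inf_PiG_dpsc (v : (dpsc i hi).Vert) : (dpsc i hi).Dv v ⊓ (dpsc i hi).PiG = (dpsc i hi).vertSub v :=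
  normalizer_map_inl_vertGp_inf_range_inl i

/-- **Prop 1.3 (v), clause 5 — no hypothesis: `Π_v` is commensurably terminal in `Π_𝔾`.**
[cite: MochizukiAbsTopII2013, Prop 1.3 (v) p.12] -/
theorem isCommensurablyTerminal_vertSub_subgroupOf_dpsc (v : (dpsc i hi).Vert) :
    IsCommensurablyTerminal (((dpsc i hi).vertSub v).subgroupOf (dpsc i hi).PiG) :=
  isCommensurablyTerminal_map_inl_vertGp_subgroupOf i

/-- **[AbsTopII] Prop 1.3 (v) — the typed `DPSCData.Prop13v` (F-0278) — at the nodal Dehn-twist datum MODULO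
the Dehn-twist fixed-subgroup input `HFix`** (clauses 1–2: `D_v = C_{Π_H}(I_v) = N_{Π_H}(I_v)`; clauses 3–5
unconditional). [cite: MochizukiAbsTopII2013, Prop 1.3 (v) p.12] -/
theorem prop13v_dpsc_of_fix
    (HFix : ∀ (x : F₂hatT) (n : ℕ), 0 < n → (∀ k : ZH, shearPow i (k ^ n) x = x) → x ∈ vertGp) :
    (dpsc i hi).toDPSCData.Prop13v := by
  intro v
  refine ⟨?_, ?_, isCommensurablyTerminal_Dv_dpsc hi v, Dv_inf_PiG_dpsc hi v,
    isCommensurablyTerminal_vertSub_subgroupOf_dpsc hi v⟩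
  · rw [Iv_dpsc_eq_range_inr_holds hi]
    exact (normalizer_map_inl_vertGp_eq i).trans (commensurator_range_inr_eq_of_fix i HFix).symm
  · rw [Iv_dpsc_eq_range_inr_holds hi]
    exact (normalizer_map_inl_vertGp_eq i).trans (normalizer_range_inr_eq_of_fix i HFix).symm

end Dpsc

/-! ### The residual of clause 2 is EXACT (appended): `D_v = N_{Π_H}(I_v)` ⟺ the fixed subgroup of the twist is `Π_v` -/

section Residual

variable (i : ℕ)

/-- **`N_{Π_H}(1 ⋊ Ẑ) = Fix(twist) ⋊ Ẑ` exactly**: `g` normalises the twist section iff `g.left` is fixed by every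
`shear^i(k)`. [cite: MochizukiAbsTopII2013, Prop 1.3 (v) p.12] -/
theorem mem_normalizer_range_inr_iff (g : Ext i) :
    g ∈ Subgroup.normalizer (((SemidirectProduct.inr : ZH →* Ext i).range : Subgroup (Ext i)) : Set (Ext i)) ↔
      ∀ k : ZH, shearPow i k g.left = g.left := by
  rw [← Subgroup.conjAct_pointwise_smul_iff, ← conj_smul_eq_toConjAct_smul]
  constructor
  · intro h k
    have hmem : g * SemidirectProduct.inr k * g⁻¹ ∈ MulAut.conj g • (SemidirectProduct.inr : ZH →* Ext i).range := by
      rw [Subgroup.mem_smul_pointwise_iff_exists]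
      exact ⟨SemidirectProduct.inr k, ⟨k, rfl⟩, by rw [MulAut.smul_def, MulAut.conj_apply]⟩
    rw [h] at hmem
    obtain ⟨k', hk'⟩ := hmem
    rw [conj_inr_eq] at hk'
    have hr := congrArg SemidirectProduct.right hk'
    simp only [SemidirectProduct.mul_right, SemidirectProduct.right_inl, SemidirectProduct.right_inr, one_mul] at hr
    have hl := congrArg SemidirectProduct.left hk'
    simp only [SemidirectProduct.mul_left, SemidirectProduct.left_inl, SemidirectProduct.right_inl,
      SemidirectProduct.left_inr, map_one, mul_one] at hl
    -- `hl : 1 = g.left * (φ_k g.left)⁻¹`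
    rw [eq_comm, mul_inv_eq_one] at hl
    exact hl.symm
  · intro h
    have hfix : ∀ k : ZH, g * SemidirectProduct.inr k * g⁻¹ = SemidirectProduct.inr k := fun k => by
      rw [conj_inr_eq, h k, mul_inv_cancel, map_one, one_mul]
    ext y
    constructor
    · intro hy
      rw [Subgroup.mem_smul_pointwise_iff_exists] at hy
      obtain ⟨_, ⟨k, rfl⟩, rfl⟩ := hy
      rw [MulAut.smul_def, MulAut.conj_apply, hfix]
      exact ⟨k, rfl⟩
    · rintro ⟨k, rfl⟩
      rw [Subgroup.mem_smul_pointwise_iff_exists]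
      exact ⟨SemidirectProduct.inr k, ⟨k, rfl⟩, by rw [MulAut.smul_def, MulAut.conj_apply, hfix]⟩

/-- **Clause 2 of Prop 1.3 (v) at the nodal datum is EQUIVALENT to the fixed-subgroup statement** «every `x ∈ F̂₂` fixed
by all `shear^i(k)`, `k ∈ Ẑ`, lies in `Π_v`» (the residual named in `prop13v_dpsc_of_fix` at `n = 1` is exact, not an
artefact of the route). [cite: MochizukiAbsTopII2013, Prop 1.3 (v) p.12] -/
theorem normalizer_range_inr_eq_iff_fix :
    Subgroup.normalizer (((SemidirectProduct.inr : ZH →* Ext i).range : Subgroup (Ext i)) : Set (Ext i)) =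
        vertGp.map (SemidirectProduct.inl : F₂hatT →* Ext i) ⊔ (SemidirectProduct.inr : ZH →* Ext i).range ↔
      ∀ x : F₂hatT, (∀ k : ZH, shearPow i k x = x) → x ∈ vertGp := by
  constructor
  · intro h x hx
    have hmem : (SemidirectProduct.inl x : Ext i) ∈ Subgroup.normalizer
        (((SemidirectProduct.inr : ZH →* Ext i).range : Subgroup (Ext i)) : Set (Ext i)) := by
      rw [mem_normalizer_range_inr_iff]
      intro k
      rw [SemidirectProduct.left_inl]
      exact hx k
    rw [h, mem_map_inl_sup_range_inr_iff (shearPow_mem_vertGp_of_mem i), SemidirectProduct.left_inl] at hmem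
    exact hmem
  · intro hfix
    refine le_antisymm (fun g hg => ?_) (map_inl_vertGp_sup_le_normalizer_range_inr i)
    rw [mem_normalizer_range_inr_iff] at hg
    rw [mem_map_inl_sup_range_inr_iff (shearPow_mem_vertGp_of_mem i)]
    exact hfix g.left hg

variable {i} (hi : 0 < i)

/-- **At `dpsc i hi`: `D_v = N_{Π_H}(I_v)` holds iff the fixed subgroup of the twist group is `Π_v`.**
[cite: MochizukiAbsTopII2013, Prop 1.3 (v) p.12] -/
theorem Dv_eq_normalizer_Iv_iff_fix (v : (dpsc i hi).Vert) :
    (dpsc i hi).Dv v = Subgroup.normalizer (((dpsc i hi).Iv v : Subgroup (dpsc i hi).PiH) : Set (dpsc i hi).PiH) ↔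
      ∀ x : F₂hatT, (∀ k : ZH, shearPow i k x = x) → x ∈ vertGp := by
  rw [Iv_dpsc_eq_range_inr_holds hi, ← normalizer_range_inr_eq_iff_fix i]
  constructor
  · intro h
    exact ((normalizer_map_inl_vertGp_eq i).symm.trans h).symm
  · intro h
    exact (normalizer_map_inl_vertGp_eq i).trans h.symm

end Residual

end Literature.AnabelianGeometry.AbsoluteAnabelian.AbsTopII.DehnTwist

end
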